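import Summits.NavierStokesRegularity.NavierStokesRegularity.Theorems.HubbleDynamoNoSelfExcitedDynamoOfTypeIAncientLiouville
import Summits.NavierStokesRegularity.NavierStokesRegularity.Theorems.SqueezeCycleExtremalBiaxialitySubcriticalIffTypeIAncientLiouville
import HarnessLib

/-!
# Crux `NoSelfExcitedDynamo` (stmt-NavierStokesRegularity-1934) lies BELOW the six-route Type-I
  Liouville node

Theorems file (lands `--supports stmt-NavierStokesRegularity-1934`; registered sub-goal
`noSelfExcitedDynamo_of_recurrentLiouville`). The tree records (file
`SqueezeCycleExtremalBiaxialitySubcriticalIffTypeIAncientLiouville.lean`, 2026-08-17) that the targets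
/ cruxes `TypeIAncientLiouville` (stmt-4050; SymmetryModuliCount, ExtremalTypeIConstant),
`RecurrentLiouville` (stmt-1589; RecurrentProfiles, SqueezeCycle), `NoTypeIRateProfile` (stmt-1588;
RecurrentProfiles, DulacContraction), `SqueezeLiouville` (stmt-11608) and `ExtremalBiaxialitySubcritical`
(stmt-11609; SqueezeCycle), `NoSingularTypeIModel` (stmt-10569; ClockStretchingLaw) are ONE node —
pairwise equivalent by kernel-checked theorems (Type-I Liouville / Type-I blow-up exclusion in the
TIME-RATE class). This file composes those equivalences with the landed bridge
`noSelfExcitedDynamo_of_typeIAncientLiouville'` (p156252): EVERY statement of the node implies this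
route's crux `NoSelfExcitedDynamo` (the same Liouville theorem in the POINTWISE Type-I class, which has
the spatial decay in addition). In particular the RECURRENT Liouville theorem of the node
(`RecurrentLiouville`: uniformly recurrent Type-I elements of the Albritton–Barker class are regular at
the vertex) implies the crux — compare the line's own open stub `stub_noRecurrentTypeIProfile`
(recurrent pointwise-Type-I profile flows vanish), its pointwise special case.
-/

noncomputable section

-- the mandated stub namespace repeats `NavierStokesRegularity` (tree precedent for this crux's stubs)
set_option linter.dupNamespace false

namespace Summit.NavierStokesRegularity.NavierStokesRegularity.Theorems.NoSelfExcitedDynamo.Registered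

/-- **`RecurrentLiouville → NoSelfExcitedDynamo`** (registered sub-goal; SqueezeCycle's spelling of
crux stmt-1589): the recurrent Type-I Liouville theorem of the node implies this route's crux
(`typeIAncientLiouville_iff_recurrentLiouville` + `noSelfExcitedDynamo_of_typeIAncientLiouville'`). -/
theorem noSelfExcitedDynamo_of_recurrentLiouville :
    Theses.SqueezeCycle.RecurrentLiouville → Theses.HubbleDynamo.NoSelfExcitedDynamo :=
  fun h => noSelfExcitedDynamo_of_typeIAncientLiouville' (typeIAncientLiouville_iff_recurrentLiouville.2 h)

/-- The same from route RecurrentProfiles' spelling of `RecurrentLiouville` (stmt-1589; identical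
definiens). -/
theorem noSelfExcitedDynamo_of_recurrentProfiles_recurrentLiouville :
    Theses.RecurrentProfiles.RecurrentLiouville → Theses.HubbleDynamo.NoSelfExcitedDynamo :=
  fun h => noSelfExcitedDynamo_of_recurrentLiouville h

/-- **`NoTypeIRateProfile → NoSelfExcitedDynamo`** (target stmt-1588 of RecurrentProfiles /
DulacContraction). -/
theorem noSelfExcitedDynamo_of_noTypeIRateProfile :
    Theses.RecurrentProfiles.NoTypeIRateProfile → Theses.HubbleDynamo.NoSelfExcitedDynamo :=
  fun h => noSelfExcitedDynamo_of_typeIAncientLiouville' (typeIAncientLiouville_iff_noTypeIRateProfile.2 h)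

/-- **`SqueezeLiouville → NoSelfExcitedDynamo`** (target stmt-11608 of SqueezeCycle). -/
theorem noSelfExcitedDynamo_of_squeezeLiouville :
    Theses.SqueezeCycle.SqueezeLiouville → Theses.HubbleDynamo.NoSelfExcitedDynamo :=
  fun h => noSelfExcitedDynamo_of_typeIAncientLiouville' (squeezeLiouville_iff_typeIAncientLiouville.1 h)

/-- **`ExtremalBiaxialitySubcritical → NoSelfExcitedDynamo`** (crux stmt-11609 of SqueezeCycle). -/
theorem noSelfExcitedDynamo_of_extremalBiaxialitySubcritical :
    Theses.SqueezeCycle.ExtremalBiaxialitySubcritical → Theses.HubbleDynamo.NoSelfExcitedDynamo :=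
  fun h => noSelfExcitedDynamo_of_typeIAncientLiouville'
    (extremalBiaxialitySubcritical_iff_typeIAncientLiouville.1 h)

/-- **`NoSingularTypeIModel → NoSelfExcitedDynamo`** (target stmt-10569 of ClockStretchingLaw). -/
theorem noSelfExcitedDynamo_of_noSingularTypeIModel :
    Theses.ClockStretchingLaw.NoSingularTypeIModel → Theses.HubbleDynamo.NoSelfExcitedDynamo :=
  fun h => noSelfExcitedDynamo_of_squeezeLiouville (squeezeLiouville_iff_noSingularTypeIModel.2 h)

end Summit.NavierStokesRegularity.NavierStokesRegularity.Theorems.NoSelfExcitedDynamo.Registered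

end
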